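import Summits.FinalStateConjecture.FinalStateConjecture.Theorems.ClusterCompletenessAdiabaticMultiKerrILEDFarSlabPrelim
import Summits.FinalStateConjecture.FinalStateConjecture.Theorems.ClusterCompletenessAdiabaticMultiKerrILEDSlabBulk

/-!
# Crux `AdiabaticMultiKerrILED` (line `Sketch`) — the generic far-field transport estimate

Helper file for the far-field Morawetz transport stub `stub_farTransport` of the line `Sketch`
(crux item `stmt-FinalStateConjecture-14310`, route `ClusterCompleteness`); no Kerr object appears.
Setting: centres `cᵢ(t) = pᵢ + t vᵢ` (`‖vᵢ‖ ≤ 1`, `70(Mᵢ+Mⱼ)`-separated for `t ≥ 0`); a measurable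
exterior `Ext ⊆ ℝ × ℝ³` containing `{∀ j, 3Mⱼ < ‖y − cⱼ(t)‖}`; a `C¹` function `ψ` normalised at
`t = 0` with exterior energy `≤ S < ∞`; a zone cut-off `ζ` (clauses of `stub_zoneCutoff`); a `C¹`
current `J` with `div J = ζ B + Err` on `{t ≥ 0}`, `B ≥ 0` continuous, `B ≥ c₀ ∑(∂ψ)²` on `{‖y‖ ≤ R}`,
the pointwise bounds of `abs_farCurrent_le` / `abs_farError_le`; measurable zones containing the
shells; the perforated Hardy inequality (stub `stub_perforatedHardy`) as hypothesis with constant `K`.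

* `far_slab_estimate` : `c₀ ∫_{(0,T]}∫_{far ball} ∑(∂ψ)² ≤ 2C_b S + C_e ∑ᵢ Zᵢ`, via
  `lintegral_nonneg_divergence_le` (registered sub-goal);
* `far_transport_estimate` : the same on `t > 0` by monotone convergence (registered sub-goal).
-/

noncomputable section

set_option linter.dupNamespace false

open scoped ContDiff Topology ENNReal
open Filter Set MeasureTheory Literature.Geometry.Lorentzian

namespace Summit.FinalStateConjecture.FinalStateConjecture.Cruxes.AdiabaticMultiKerrILED.Sketch

/-! ### The slab estimate -/

/-- **The far-field transport estimate on a slab `(0, T]`** (generic form). Moving centres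
`cᵢ(t) = pᵢ + t vᵢ` (`‖vᵢ‖ ≤ 1`, `70(Mᵢ+Mⱼ)`-separated for `t ≥ 0`), a measurable exterior `Ext` of the
slab containing `{∀ j, 3Mⱼ < ‖y − cⱼ(t)‖}`, a `C¹` function `ψ` normalised at `t = 0` with exterior
energy `≤ S < ∞`, a zone cut-off `ζ` (the six clauses of `stub_zoneCutoff`), a `C¹` current `J` with
`div J = ζ B + Err` on `{t ≥ 0}`, `B ≥ 0` continuous with `B ≥ c₀ ∑(∂ψ)²` on `{‖y‖ ≤ R}`, the pointwise
bounds of `abs_farCurrent_le` / `abs_farError_le`, zones `Zoneᵢ` containing the shells, and the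
perforated Hardy inequality with constant `K`. Then
`c₀ ∫_{(0,T]} ∫_{‖y‖ ≤ R, ∀ i 35Mᵢ ≤ ‖y − cᵢ(t)‖} ∑(∂ψ)² ≤ 2 C_b S + C_e ∑ᵢ ∫_{t>0}∫_{Zoneᵢ(t)} (∑(∂ψ)² + (ψ−c)²/Mᵢ²)`
with `C_b = 5 + 12K + (K_ζ/R)·1156K∑Mᵢ²`, `C_e = 18K_ζ + 36K_ζ∑Mᵢ² + 1`. [folklore] -/
theorem far_slab_estimate {K : NNReal}
    (hPH : ∀ (n : ℕ) (c : Fin n → E3) (ρ : Fin n → ℝ), (∀ i, 0 < ρ i) →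
      (∀ i j, i ≠ j → 4 * (ρ i + ρ j) ≤ dist (c i) (c j)) →
      ∀ φ : E3 → ℝ, (∀ y : E3, (∀ i, ρ i < dist y (c i)) → ContDiffAt ℝ 1 φ y) →
      (∃ ρ₀ : ℝ, ∫⁻ y in {y : E3 | ρ₀ < ‖y‖}, ENNReal.ofReal (φ y ^ 2 / ‖y‖ ^ 2) < ⊤) →
      ∀ y₀ : E3, ∫⁻ y in {y : E3 | ∀ i, 2 * ρ i < dist y (c i)},
          ENNReal.ofReal (φ y ^ 2 / ‖y - y₀‖ ^ 2) ≤
        (K : ENNReal) * ∫⁻ y in {y : E3 | ∀ i, ρ i < dist y (c i)}, ENNReal.ofReal (‖fderiv ℝ φ y‖ ^ 2))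
    {N : ℕ} {M : Fin N → ℝ} (hM : ∀ i, 0 < M i) {p v : Fin N → E3} (hv1 : ∀ i, ‖v i‖ ≤ 1)
    (hsep : ∀ t : ℝ, 0 ≤ t → ∀ i j, i ≠ j → 70 * (M i + M j) ≤ ‖(p i + t • v i) - (p j + t • v j)‖)
    {Ext : Set (ℝ × E3)} (hExtm : MeasurableSet Ext)
    (hext : ∀ t : ℝ, 0 ≤ t → ∀ y : E3, (∀ j, 3 * M j < ‖y - p j - t • v j‖) → (t, y) ∈ Ext)
    {ψ : E4 → ℝ} (hψ : ContDiff ℝ 1 ψ) (c : ℝ)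
    (hnorm : ∃ ρ : ℝ, ∫⁻ y in {y : E3 | ρ < ‖y‖},
      ENNReal.ofReal ((ψ (E4.ofTimeSpace 0 y) - c) ^ 2 / ‖y‖ ^ 2) < ⊤)
    {S : ℝ≥0∞} (hS : ∀ t : ℝ, 0 ≤ t → ∫⁻ y in {y : E3 | (t, y) ∈ Ext},
      ENNReal.ofReal (∑ κ : Fin 4, (fderiv ℝ ψ (E4.ofTimeSpace t y) (E4.basisVector κ)) ^ 2) ≤ S)
    (hStop : S ≠ ⊤)
    {ζ : E4 → ℝ} (hζc : Continuous ζ) (hζ01 : ∀ x, 0 ≤ ζ x ∧ ζ x ≤ 1)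
    (hζ0 : ∀ x : E4, (∃ i, ‖E4.spatial x - p i - (x 0) • v i‖ < 17 * M i) → ζ =ᶠ[𝓝 x] fun _ ↦ 0)
    (hζ1 : ∀ x : E4, (∀ i, 34 * M i < ‖E4.spatial x - p i - (x 0) • v i‖) → ζ =ᶠ[𝓝 x] fun _ ↦ 1)
    (hζsupp : ∀ x : E4, ζ x ≠ 0 → ∀ i, 17 * M i ≤ ‖E4.spatial x - p i - (x 0) • v i‖)
    {Kζ : ℝ} (hKζ : ∀ x : E4, 0 ≤ x 0 → ‖fderiv ℝ ζ x‖ ≤ Kζ ∧ ‖fderiv ℝ (fderiv ℝ ζ) x‖ ≤ Kζ)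
    {J : Fin 4 → E4 → ℝ} (hJ : ∀ μ, ContDiff ℝ 1 (J μ))
    {B Err : E4 → ℝ} (hBc : Continuous B) (hB0 : ∀ x, 0 ≤ B x) (hErrc : Continuous Err)
    {R c₀ : ℝ} (hR : 1 ≤ R) (hc₀ : 0 < c₀)
    (hBlow : ∀ x : E4, E4.spatialNorm x ≤ R →
      c₀ * ∑ κ : Fin 4, (fderiv ℝ ψ x (E4.basisVector κ)) ^ 2 ≤ B x)
    (hdiv : ∀ x : E4, 0 ≤ x 0 → ∑ μ, fderiv ℝ (J μ) x (E4.basisVector μ) = ζ x * B x + Err x)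
    (hJb : ∀ (x : E4) (μ : Fin 4), 0 ≤ x 0 →
      |J μ x| ≤ 5 * ζ x * (∑ κ, (fderiv ℝ ψ x (E4.basisVector κ)) ^ 2) +
        12 * ζ x * ((ψ x - c) ^ 2 / (E4.spatialNorm x + R) ^ 2) +
        |fderiv ℝ ζ x (E4.basisVector μ)| * ((ψ x - c) ^ 2 / (E4.spatialNorm x + R)))
    (hErrb : ∀ x : E4, 0 ≤ x 0 →
      |Err x| ≤ 18 * ‖fderiv ℝ ζ x‖ * (∑ κ, (fderiv ℝ ψ x (E4.basisVector κ)) ^ 2) +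
        (32 * ‖fderiv ℝ ζ x‖ / (E4.spatialNorm x + R) ^ 2 +
          4 * ‖fderiv ℝ (fderiv ℝ ζ) x‖ / (E4.spatialNorm x + R)) * (ψ x - c) ^ 2)
    {Zone : Fin N → Set (ℝ × E3)} (hZm : ∀ i, MeasurableSet (Zone i))
    (hshell : ∀ t : ℝ, 0 ≤ t → ∀ (y : E3) (i : Fin N), ‖y - p i - t • v i‖ ≤ 34 * M i →
      (∀ j, 17 * M j ≤ ‖y - p j - t • v j‖) → (t, y) ∈ Zone i)
    {T : ℝ} (hT : 0 ≤ T) :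
    ENNReal.ofReal c₀ * ∫⁻ t in Ioc (0 : ℝ) T,
        ∫⁻ y in {y : E3 | ‖y‖ ≤ R ∧ ∀ i, 35 * M i ≤ ‖y - p i - t • v i‖},
          ENNReal.ofReal (∑ κ : Fin 4, (fderiv ℝ ψ (E4.ofTimeSpace t y) (E4.basisVector κ)) ^ 2) ≤
      2 * ENNReal.ofReal (5 + 12 * K + Kζ / R * (1156 * K * ∑ i, M i ^ 2)) * S +
        ENNReal.ofReal (18 * Kζ + 36 * Kζ * (∑ i, M i ^ 2) + 1) *
          ∑ i, ∫⁻ t in Ioi (0 : ℝ), ∫⁻ y in {y : E3 | (t, y) ∈ Zone i},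
            (ENNReal.ofReal (∑ κ : Fin 4, (fderiv ℝ ψ (E4.ofTimeSpace t y) (E4.basisVector κ)) ^ 2) +
              ENNReal.ofReal ((ψ (E4.ofTimeSpace t y) - c) ^ 2 / M i ^ 2)) := by
  -- names
  set Pd : E4 → ℝ := fun x ↦ ∑ κ : Fin 4, (fderiv ℝ ψ x (E4.basisVector κ)) ^ 2 with hPd
  set Cb : ℝ := 5 + 12 * K + Kζ / R * (1156 * K * ∑ i, M i ^ 2) with hCb
  set Ce : ℝ := 18 * Kζ + 36 * Kζ * (∑ i, M i ^ 2) + 1 with hCe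
  set Z : Fin N → ℝ≥0∞ := fun i ↦ ∫⁻ t in Ioi (0 : ℝ), ∫⁻ y in {y : E3 | (t, y) ∈ Zone i},
    (ENNReal.ofReal (∑ κ : Fin 4, (fderiv ℝ ψ (E4.ofTimeSpace t y) (E4.basisVector κ)) ^ 2) +
      ENNReal.ofReal ((ψ (E4.ofTimeSpace t y) - c) ^ 2 / M i ^ 2)) with hZ
  set g : Fin N → ℝ × E3 → ℝ≥0∞ := fun i q ↦ ENNReal.ofReal Ce *
    (ENNReal.ofReal (Pd (E4.ofTimeSpace q.1 q.2)) +
      ENNReal.ofReal ((ψ (E4.ofTimeSpace q.1 q.2) - c) ^ 2 / M i ^ 2)) with hg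
  -- elementary facts
  have hKζ0 : 0 ≤ Kζ :=
    (norm_nonneg _).trans (hKζ (E4.ofTimeSpace 0 0) (le_of_eq (E4.ofTimeSpace_apply_zero 0 0).symm)).1
  have hM2 : 0 ≤ ∑ i, M i ^ 2 := Finset.sum_nonneg fun i _ ↦ sq_nonneg _
  have hCepos : 0 < Ce := by rw [hCe]; positivity
  have hPd0 : ∀ x, 0 ≤ Pd x := fun x ↦ Finset.sum_nonneg fun _ _ ↦ sq_nonneg _
  have hPdc : Continuous fun q : ℝ × E3 ↦ Pd (E4.ofTimeSpace q.1 q.2) :=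
    continuous_energyDensity_uncurry hψ
  have hφc : Continuous fun q : ℝ × E3 ↦ ψ (E4.ofTimeSpace q.1 q.2) - c :=
    (hψ.continuous.comp E4.continuous_ofTimeSpace_uncurry).sub continuous_const
  have hgm : ∀ i, Measurable (g i) := fun i ↦
    ((ENNReal.measurable_ofReal.comp hPdc.measurable).add
      (ENNReal.measurable_ofReal.comp ((hφc.pow 2).div_const _).measurable)).const_mul _
  -- the trivial case `Zᵢ = ∞`
  by_cases hZtop : ∃ i, Z i = ⊤
  · obtain ⟨i, hi⟩ := hZtop
    have hsum : ∑ i, Z i = ⊤ := ENNReal.sum_eq_top.mpr ⟨i, Finset.mem_univ _, hi⟩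
    have hCe0 : ENNReal.ofReal Ce ≠ 0 := fun h ↦ absurd (ENNReal.ofReal_eq_zero.mp h) (not_le.mpr hCepos)
    calc _ ≤ (⊤ : ℝ≥0∞) := le_top
      _ = _ := by rw [hsum, ENNReal.mul_top hCe0, add_top]
  push Not at hZtop
  -- fixed-time facts
  have hdect : ∀ t : ℝ, 0 ≤ t → ∃ ρ₀ : ℝ, ∫⁻ y in {y : E3 | ρ₀ < ‖y‖},
      ENNReal.ofReal ((ψ (E4.ofTimeSpace t y) - c) ^ 2 / ‖y‖ ^ 2) < ⊤ := fun t ht ↦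
    decay_at_time hM hv1 hext hψ c hnorm hS hStop ht
  have hJS : ∀ t : ℝ, 0 ≤ t → ∀ μ, ∫⁻ y, ENNReal.ofReal (|J μ (E4.ofTimeSpace t y)|) ≤
      ENNReal.ofReal Cb * S := by
    intro t ht μ
    refine (lintegral_abs_slice_le hPH hM hsep hExtm hext hψ c hζ01 hζ0 hζ1 hζsupp
      (fun x hx ↦ (hKζ x hx).1) (lt_of_lt_of_le one_pos hR) (F := J μ) (μ := μ)
      (fun x hx ↦ hJb x μ hx) ht (hdect t ht)).trans ?_
    exact mul_le_mul' le_rfl (hS t ht)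
  have hJint : ∀ t : ℝ, 0 ≤ t → ∀ μ, Integrable (fun y : E3 ↦ J μ (E4.ofTimeSpace t y)) := by
    intro t ht μ
    refine ⟨((hJ μ).continuous.comp (E4.continuous_ofTimeSpace t)).aestronglyMeasurable, ?_⟩
    show ∫⁻ y, ‖J μ (E4.ofTimeSpace t y)‖ₑ < ⊤
    simp_rw [Real.enorm_eq_ofReal_abs]
    exact (hJS t ht μ).trans_lt (ENNReal.mul_lt_top ENNReal.ofReal_lt_top hStop.lt_top)
  -- slab integrability of the current
  have hJslab : ∀ μ, Integrable (fun q : ℝ × E3 ↦ J μ (E4.ofTimeSpace q.1 q.2))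
      ((volume.restrict (Ioc 0 T)).prod volume) := by
    intro μ
    have hc : Continuous fun q : ℝ × E3 ↦ J μ (E4.ofTimeSpace q.1 q.2) :=
      (hJ μ).continuous.comp E4.continuous_ofTimeSpace_uncurry
    refine ⟨hc.aestronglyMeasurable, ?_⟩
    show ∫⁻ q, ‖J μ (E4.ofTimeSpace q.1 q.2)‖ₑ ∂((volume.restrict (Ioc 0 T)).prod volume) < ⊤
    simp_rw [Real.enorm_eq_ofReal_abs]
    rw [lintegral_prod (fun q : ℝ × E3 ↦ ENNReal.ofReal (|J μ (E4.ofTimeSpace q.1 q.2)|))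
      (ENNReal.measurable_ofReal.comp hc.abs.measurable).aemeasurable]
    calc ∫⁻ t in Ioc 0 T, ∫⁻ y, ENNReal.ofReal (|J μ (E4.ofTimeSpace (t, y).1 (t, y).2)|)
        ≤ ∫⁻ t in Ioc 0 T, ENNReal.ofReal Cb * S :=
          setLIntegral_mono' measurableSet_Ioc fun t ht ↦ hJS t ht.1.le μ
      _ = ENNReal.ofReal Cb * S * volume (Ioc 0 T) := setLIntegral_const _ _
      _ < ⊤ := ENNReal.mul_lt_top (ENNReal.mul_lt_top ENNReal.ofReal_lt_top hStop.lt_top)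
          measure_Ioc_lt_top
  -- the pointwise zone bound of the error term
  have hErr_pt : ∀ q : ℝ × E3, 0 ≤ q.1 →
      ENNReal.ofReal (|Err (E4.ofTimeSpace q.1 q.2)|) ≤ ∑ i, (Zone i).indicator (g i) q := by
    intro q hq
    set x : E4 := E4.ofTimeSpace q.1 q.2 with hx
    have hx0 : 0 ≤ x 0 := by rw [hx, E4.ofTimeSpace_apply_zero]; exact hq
    have hdx : ∀ i, ‖E4.spatial x - p i - (x 0) • v i‖ = ‖q.2 - p i - q.1 • v i‖ := fun i ↦ by
      rw [hx, norm_spatial_ofTimeSpace_sub]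
    by_cases hsh : (∃ i, ‖q.2 - p i - q.1 • v i‖ ≤ 34 * M i) ∧ ∀ j, 17 * M j ≤ ‖q.2 - p j - q.1 • v j‖
    · obtain ⟨⟨i, hi⟩, h17⟩ := hsh
      have hmem : q ∈ Zone i := by
        have := hshell q.1 hq q.2 i hi h17
        rwa [Prod.mk.eta] at this
      have hsingle : (Zone i).indicator (g i) q ≤ ∑ j, (Zone j).indicator (g j) q :=
        Finset.single_le_sum (f := fun j ↦ (Zone j).indicator (g j) q) (fun _ _ ↦ bot_le)
          (Finset.mem_univ i)
      refine le_trans ?_ hsingle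
      rw [indicator_of_mem hmem, hg]
      simp only
      rw [← hx, ← ENNReal.ofReal_add (hPd0 x) (by positivity), ← ENNReal.ofReal_mul hCepos.le]
      refine ENNReal.ofReal_le_ofReal ((hErrb x hx0).trans ?_)
      -- real bookkeeping on the shell
      have hD1 : ‖fderiv ℝ ζ x‖ ≤ Kζ := (hKζ x hx0).1
      have hD2 : ‖fderiv ℝ (fderiv ℝ ζ) x‖ ≤ Kζ := (hKζ x hx0).2
      have hsN : 0 ≤ E4.spatialNorm x := E4.spatialNorm_nonneg x
      have hden1 : 1 ≤ E4.spatialNorm x + R := by linarith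
      have hfrac1 : 32 * ‖fderiv ℝ ζ x‖ / (E4.spatialNorm x + R) ^ 2 ≤ 32 * Kζ :=
        (div_le_self (by positivity) (by nlinarith)).trans (by linarith)
      have hfrac2 : 4 * ‖fderiv ℝ (fderiv ℝ ζ) x‖ / (E4.spatialNorm x + R) ≤ 4 * Kζ :=
        (div_le_self (by positivity) hden1).trans (by linarith)
      have hφsq : (ψ x - c) ^ 2 ≤ (∑ j, M j ^ 2) * ((ψ x - c) ^ 2 / M i ^ 2) := by
        have hMi := hM i
        have hMi2 : M i ^ 2 ≤ ∑ j, M j ^ 2 :=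
          Finset.single_le_sum (f := fun j ↦ M j ^ 2) (fun _ _ ↦ sq_nonneg _) (Finset.mem_univ i)
        calc (ψ x - c) ^ 2 = M i ^ 2 * ((ψ x - c) ^ 2 / M i ^ 2) := by field_simp
          _ ≤ (∑ j, M j ^ 2) * ((ψ x - c) ^ 2 / M i ^ 2) :=
              mul_le_mul_of_nonneg_right hMi2 (by positivity)
      have hP := hPd0 x
      have hq0 : 0 ≤ (ψ x - c) ^ 2 / M i ^ 2 := by positivity
      calc 18 * ‖fderiv ℝ ζ x‖ * Pd x +
            (32 * ‖fderiv ℝ ζ x‖ / (E4.spatialNorm x + R) ^ 2 +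
              4 * ‖fderiv ℝ (fderiv ℝ ζ) x‖ / (E4.spatialNorm x + R)) * (ψ x - c) ^ 2
          ≤ 18 * Kζ * Pd x + (32 * Kζ + 4 * Kζ) * ((∑ j, M j ^ 2) * ((ψ x - c) ^ 2 / M i ^ 2)) := by
            gcongr
        _ ≤ Ce * Pd x + Ce * ((ψ x - c) ^ 2 / M i ^ 2) := by
            have h1 : 18 * Kζ ≤ Ce := by rw [hCe]; nlinarith
            have h2 : (32 * Kζ + 4 * Kζ) * (∑ j, M j ^ 2) ≤ Ce := by rw [hCe]; nlinarith
            nlinarith [mul_le_mul_of_nonneg_right h1 hP, mul_le_mul_of_nonneg_right h2 hq0]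
        _ = Ce * (Pd x + (ψ x - c) ^ 2 / M i ^ 2) := by ring
    · have h0 := fderiv_eq_zero_of_not_shell hζ0 hζ1 (x := x) (by simpa only [hdx] using hsh)
      have e1 : ‖fderiv ℝ ζ x‖ = 0 := by rw [h0.1]; simp
      have e2 : ‖fderiv ℝ (fderiv ℝ ζ) x‖ = 0 := by
        rw [h0.2]; exact ContinuousLinearMap.opNorm_zero
      have hE0 : Err x = 0 := by
        refine abs_nonpos_iff.mp ?_
        calc |Err x| ≤ _ := hErrb x hx0
          _ = 0 := by rw [e1, e2]; ring
      rw [hE0, abs_zero, ENNReal.ofReal_zero]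
      exact bot_le
  -- the slab bound of the error term
  have hErr_meas : Measurable fun q : ℝ × E3 ↦ ENNReal.ofReal (|Err (E4.ofTimeSpace q.1 q.2)|) :=
    ENNReal.measurable_ofReal.comp (hErrc.comp E4.continuous_ofTimeSpace_uncurry).abs.measurable
  have hZi : ∀ i, ∫⁻ t in Ioc 0 T, ∫⁻ y, (Zone i).indicator (g i) (t, y) ≤ ENNReal.ofReal Ce * Z i := by
    intro i
    calc ∫⁻ t in Ioc 0 T, ∫⁻ y, (Zone i).indicator (g i) (t, y)
        ≤ ∫⁻ t in Ioi 0, ∫⁻ y, (Zone i).indicator (g i) (t, y) := lintegral_mono_set Ioc_subset_Ioi_self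
      _ = ∫⁻ t in Ioi 0, ∫⁻ y in {y : E3 | (t, y) ∈ Zone i}, g i (t, y) :=
          lintegral_congr fun t ↦ (setLIntegral_slice_eq_lintegral_indicator (hZm i) (g i) t).symm
      _ = ENNReal.ofReal Ce * Z i := by
          rw [hZ]
          simp only
          rw [← lintegral_const_mul' _ _ ENNReal.ofReal_ne_top]
          refine lintegral_congr fun t ↦ ?_
          rw [← lintegral_const_mul' _ _ ENNReal.ofReal_ne_top]
  have hErr_slab : ∫⁻ q, ENNReal.ofReal (|Err (E4.ofTimeSpace q.1 q.2)|)
      ∂((volume.restrict (Ioc 0 T)).prod volume) ≤ ENNReal.ofReal Ce * ∑ i, Z i := by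
    rw [lintegral_prod _ hErr_meas.aemeasurable]
    calc ∫⁻ t in Ioc 0 T, ∫⁻ y, ENNReal.ofReal (|Err (E4.ofTimeSpace (t, y).1 (t, y).2)|)
        ≤ ∫⁻ t in Ioc 0 T, ∫⁻ y, ∑ i, (Zone i).indicator (g i) (t, y) :=
          setLIntegral_mono' measurableSet_Ioc fun t ht ↦ lintegral_mono fun y ↦ hErr_pt (t, y) ht.1.le
      _ = ∫⁻ t in Ioc 0 T, ∑ i, ∫⁻ y, (Zone i).indicator (g i) (t, y) :=
          lintegral_congr fun t ↦ lintegral_finsetSum _ fun i _ ↦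
            ((hgm i).indicator (hZm i)).comp measurable_prodMk_left
      _ = ∑ i, ∫⁻ t in Ioc 0 T, ∫⁻ y, (Zone i).indicator (g i) (t, y) :=
          lintegral_finsetSum _ fun i _ ↦ ((hgm i).indicator (hZm i)).lintegral_prod_right'
      _ ≤ ∑ i, ENNReal.ofReal Ce * Z i := Finset.sum_le_sum fun i _ ↦ hZi i
      _ = ENNReal.ofReal Ce * ∑ i, Z i := (Finset.mul_sum _ _ _).symm
  have hErr_int : Integrable (fun q : ℝ × E3 ↦ Err (E4.ofTimeSpace q.1 q.2))
      ((volume.restrict (Ioc 0 T)).prod volume) := by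
    refine ⟨(hErrc.comp E4.continuous_ofTimeSpace_uncurry).aestronglyMeasurable, ?_⟩
    show ∫⁻ q, ‖Err (E4.ofTimeSpace q.1 q.2)‖ₑ ∂((volume.restrict (Ioc 0 T)).prod volume) < ⊤
    simp_rw [Real.enorm_eq_ofReal_abs]
    refine hErr_slab.trans_lt (ENNReal.mul_lt_top ENNReal.ofReal_lt_top ?_)
    exact ENNReal.sum_lt_top.mpr fun i _ ↦ (hZtop i).lt_top
  -- the divergence identity on the slab
  have hmain := lintegral_nonneg_divergence_le J (fun x ↦ ζ x * B x) Err 0 T hT hJ (hζc.mul hBc)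
    (fun x ↦ mul_nonneg (hζ01 x).1 (hB0 x)) hErrc (fun x hx0 _ ↦ hdiv x hx0) (hJint 0 le_rfl 0)
    (hJint T hT 0) hJslab hErr_int
  -- the lower bound: `ζ = 1` and `B ≥ c₀ P` on the far ball
  have hball : ∀ t : ℝ, MeasurableSet {y : E3 | ‖y‖ ≤ R ∧ ∀ i, 35 * M i ≤ ‖y - p i - t • v i‖} := by
    intro t
    have h1 : MeasurableSet {y : E3 | ‖y‖ ≤ R} := (isClosed_le continuous_norm continuous_const).measurableSet
    have h2 : ∀ i, MeasurableSet {y : E3 | 35 * M i ≤ ‖y - p i - t • v i‖} := fun i ↦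
      (isClosed_le continuous_const ((continuous_id.sub continuous_const).sub continuous_const).norm).measurableSet
    have : {y : E3 | ‖y‖ ≤ R ∧ ∀ i, 35 * M i ≤ ‖y - p i - t • v i‖} =
        {y : E3 | ‖y‖ ≤ R} ∩ ⋂ i, {y : E3 | 35 * M i ≤ ‖y - p i - t • v i‖} := by
      ext y; simp
    rw [this]
    exact h1.inter (MeasurableSet.iInter h2)
  have hζB_meas : Measurable fun q : ℝ × E3 ↦
      ENNReal.ofReal (ζ (E4.ofTimeSpace q.1 q.2) * B (E4.ofTimeSpace q.1 q.2)) :=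
    ENNReal.measurable_ofReal.comp
      ((hζc.mul hBc).comp E4.continuous_ofTimeSpace_uncurry).measurable
  have hlow : ENNReal.ofReal c₀ * ∫⁻ t in Ioc (0 : ℝ) T,
      ∫⁻ y in {y : E3 | ‖y‖ ≤ R ∧ ∀ i, 35 * M i ≤ ‖y - p i - t • v i‖},
        ENNReal.ofReal (∑ κ : Fin 4, (fderiv ℝ ψ (E4.ofTimeSpace t y) (E4.basisVector κ)) ^ 2) ≤
      ∫⁻ q, ENNReal.ofReal (ζ (E4.ofTimeSpace q.1 q.2) * B (E4.ofTimeSpace q.1 q.2))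
        ∂((volume.restrict (Ioc 0 T)).prod volume) := by
    rw [lintegral_prod _ hζB_meas.aemeasurable, ← lintegral_const_mul' _ _ ENNReal.ofReal_ne_top]
    refine lintegral_mono fun t ↦ ?_
    rw [← lintegral_const_mul' _ _ ENNReal.ofReal_ne_top]
    refine (setLIntegral_mono' (hball t) fun y hy ↦ ?_).trans (setLIntegral_le_lintegral _ _)
    rw [← ENNReal.ofReal_mul hc₀.le]
    refine ENNReal.ofReal_le_ofReal ?_
    have hζone : ζ (E4.ofTimeSpace t y) = 1 := by
      refine (hζ1 (E4.ofTimeSpace t y) fun i ↦ ?_).self_of_nhds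
      rw [norm_spatial_ofTimeSpace_sub]
      have := hy.2 i
      have := hM i
      linarith
    show c₀ * _ ≤ ζ (E4.ofTimeSpace t y) * B (E4.ofTimeSpace t y)
    rw [hζone, one_mul]
    exact hBlow _ (by rw [E4.spatialNorm_ofTimeSpace]; exact hy.1)
  -- the upper bounds
  have hI0 : ∀ t : ℝ, 0 ≤ t → ENNReal.ofReal (∫ y, |J 0 (E4.ofTimeSpace t y)|) ≤ ENNReal.ofReal Cb * S := by
    intro t ht
    rw [ofReal_integral_eq_lintegral_ofReal (hJint t ht 0).abs (ae_of_all _ fun y ↦ abs_nonneg _)]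
    exact hJS t ht 0
  have hIE : ENNReal.ofReal (∫ q, |Err (E4.ofTimeSpace q.1 q.2)| ∂((volume.restrict (Ioc 0 T)).prod volume)) ≤
      ENNReal.ofReal Ce * ∑ i, Z i := by
    rw [ofReal_integral_eq_lintegral_ofReal hErr_int.abs (ae_of_all _ fun q ↦ abs_nonneg _)]
    exact hErr_slab
  have hn1 : 0 ≤ ∫ y, |J 0 (E4.ofTimeSpace T y)| := integral_nonneg fun _ ↦ abs_nonneg _
  have hn2 : 0 ≤ ∫ y, |J 0 (E4.ofTimeSpace 0 y)| := integral_nonneg fun _ ↦ abs_nonneg _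
  have hn3 : 0 ≤ ∫ q, |Err (E4.ofTimeSpace q.1 q.2)| ∂((volume.restrict (Ioc 0 T)).prod volume) :=
    integral_nonneg fun _ ↦ abs_nonneg _
  calc _ ≤ _ := hlow
    _ ≤ _ := hmain
    _ = ENNReal.ofReal (∫ y, |J 0 (E4.ofTimeSpace T y)|) + ENNReal.ofReal (∫ y, |J 0 (E4.ofTimeSpace 0 y)|) +
          ENNReal.ofReal (∫ q, |Err (E4.ofTimeSpace q.1 q.2)| ∂((volume.restrict (Ioc 0 T)).prod volume)) := by
        rw [ENNReal.ofReal_add (add_nonneg hn1 hn2) hn3, ENNReal.ofReal_add hn1 hn2]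
    _ ≤ ENNReal.ofReal Cb * S + ENNReal.ofReal Cb * S + ENNReal.ofReal Ce * ∑ i, Z i :=
        add_le_add (add_le_add (hI0 T hT) (hI0 0 le_rfl)) hIE
    _ = 2 * ENNReal.ofReal Cb * S + ENNReal.ofReal Ce * ∑ i, Z i := by ring

/-! ### The transport estimate on `t > 0` -/

/-- **The far-field transport estimate** (generic form): the slab estimate `far_slab_estimate` with
`T → ∞` by monotone convergence. [folklore] -/
theorem far_transport_estimate {K : NNReal}
    (hPH : ∀ (n : ℕ) (c : Fin n → E3) (ρ : Fin n → ℝ), (∀ i, 0 < ρ i) →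
      (∀ i j, i ≠ j → 4 * (ρ i + ρ j) ≤ dist (c i) (c j)) →
      ∀ φ : E3 → ℝ, (∀ y : E3, (∀ i, ρ i < dist y (c i)) → ContDiffAt ℝ 1 φ y) →
      (∃ ρ₀ : ℝ, ∫⁻ y in {y : E3 | ρ₀ < ‖y‖}, ENNReal.ofReal (φ y ^ 2 / ‖y‖ ^ 2) < ⊤) →
      ∀ y₀ : E3, ∫⁻ y in {y : E3 | ∀ i, 2 * ρ i < dist y (c i)},
          ENNReal.ofReal (φ y ^ 2 / ‖y - y₀‖ ^ 2) ≤
        (K : ENNReal) * ∫⁻ y in {y : E3 | ∀ i, ρ i < dist y (c i)}, ENNReal.ofReal (‖fderiv ℝ φ y‖ ^ 2))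
    {N : ℕ} {M : Fin N → ℝ} (hM : ∀ i, 0 < M i) {p v : Fin N → E3} (hv1 : ∀ i, ‖v i‖ ≤ 1)
    (hsep : ∀ t : ℝ, 0 ≤ t → ∀ i j, i ≠ j → 70 * (M i + M j) ≤ ‖(p i + t • v i) - (p j + t • v j)‖)
    {Ext : Set (ℝ × E3)} (hExtm : MeasurableSet Ext)
    (hext : ∀ t : ℝ, 0 ≤ t → ∀ y : E3, (∀ j, 3 * M j < ‖y - p j - t • v j‖) → (t, y) ∈ Ext)
    {ψ : E4 → ℝ} (hψ : ContDiff ℝ 1 ψ) (c : ℝ)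
    (hnorm : ∃ ρ : ℝ, ∫⁻ y in {y : E3 | ρ < ‖y‖},
      ENNReal.ofReal ((ψ (E4.ofTimeSpace 0 y) - c) ^ 2 / ‖y‖ ^ 2) < ⊤)
    {S : ℝ≥0∞} (hS : ∀ t : ℝ, 0 ≤ t → ∫⁻ y in {y : E3 | (t, y) ∈ Ext},
      ENNReal.ofReal (∑ κ : Fin 4, (fderiv ℝ ψ (E4.ofTimeSpace t y) (E4.basisVector κ)) ^ 2) ≤ S)
    (hStop : S ≠ ⊤)
    {ζ : E4 → ℝ} (hζc : Continuous ζ) (hζ01 : ∀ x, 0 ≤ ζ x ∧ ζ x ≤ 1)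
    (hζ0 : ∀ x : E4, (∃ i, ‖E4.spatial x - p i - (x 0) • v i‖ < 17 * M i) → ζ =ᶠ[𝓝 x] fun _ ↦ 0)
    (hζ1 : ∀ x : E4, (∀ i, 34 * M i < ‖E4.spatial x - p i - (x 0) • v i‖) → ζ =ᶠ[𝓝 x] fun _ ↦ 1)
    (hζsupp : ∀ x : E4, ζ x ≠ 0 → ∀ i, 17 * M i ≤ ‖E4.spatial x - p i - (x 0) • v i‖)
    {Kζ : ℝ} (hKζ : ∀ x : E4, 0 ≤ x 0 → ‖fderiv ℝ ζ x‖ ≤ Kζ ∧ ‖fderiv ℝ (fderiv ℝ ζ) x‖ ≤ Kζ)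
    {J : Fin 4 → E4 → ℝ} (hJ : ∀ μ, ContDiff ℝ 1 (J μ))
    {B Err : E4 → ℝ} (hBc : Continuous B) (hB0 : ∀ x, 0 ≤ B x) (hErrc : Continuous Err)
    {R c₀ : ℝ} (hR : 1 ≤ R) (hc₀ : 0 < c₀)
    (hBlow : ∀ x : E4, E4.spatialNorm x ≤ R →
      c₀ * ∑ κ : Fin 4, (fderiv ℝ ψ x (E4.basisVector κ)) ^ 2 ≤ B x)
    (hdiv : ∀ x : E4, 0 ≤ x 0 → ∑ μ, fderiv ℝ (J μ) x (E4.basisVector μ) = ζ x * B x + Err x)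
    (hJb : ∀ (x : E4) (μ : Fin 4), 0 ≤ x 0 →
      |J μ x| ≤ 5 * ζ x * (∑ κ, (fderiv ℝ ψ x (E4.basisVector κ)) ^ 2) +
        12 * ζ x * ((ψ x - c) ^ 2 / (E4.spatialNorm x + R) ^ 2) +
        |fderiv ℝ ζ x (E4.basisVector μ)| * ((ψ x - c) ^ 2 / (E4.spatialNorm x + R)))
    (hErrb : ∀ x : E4, 0 ≤ x 0 →
      |Err x| ≤ 18 * ‖fderiv ℝ ζ x‖ * (∑ κ, (fderiv ℝ ψ x (E4.basisVector κ)) ^ 2) +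
        (32 * ‖fderiv ℝ ζ x‖ / (E4.spatialNorm x + R) ^ 2 +
          4 * ‖fderiv ℝ (fderiv ℝ ζ) x‖ / (E4.spatialNorm x + R)) * (ψ x - c) ^ 2)
    {Zone : Fin N → Set (ℝ × E3)} (hZm : ∀ i, MeasurableSet (Zone i))
    (hshell : ∀ t : ℝ, 0 ≤ t → ∀ (y : E3) (i : Fin N), ‖y - p i - t • v i‖ ≤ 34 * M i →
      (∀ j, 17 * M j ≤ ‖y - p j - t • v j‖) → (t, y) ∈ Zone i) :
    ENNReal.ofReal c₀ * ∫⁻ t in Ioi (0 : ℝ),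
        ∫⁻ y in {y : E3 | ‖y‖ ≤ R ∧ ∀ i, 35 * M i ≤ ‖y - p i - t • v i‖},
          ENNReal.ofReal (∑ κ : Fin 4, (fderiv ℝ ψ (E4.ofTimeSpace t y) (E4.basisVector κ)) ^ 2) ≤
      2 * ENNReal.ofReal (5 + 12 * K + Kζ / R * (1156 * K * ∑ i, M i ^ 2)) * S +
        ENNReal.ofReal (18 * Kζ + 36 * Kζ * (∑ i, M i ^ 2) + 1) *
          ∑ i, ∫⁻ t in Ioi (0 : ℝ), ∫⁻ y in {y : E3 | (t, y) ∈ Zone i},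
            (ENNReal.ofReal (∑ κ : Fin 4, (fderiv ℝ ψ (E4.ofTimeSpace t y) (E4.basisVector κ)) ^ 2) +
              ENNReal.ofReal ((ψ (E4.ofTimeSpace t y) - c) ^ 2 / M i ^ 2)) := by
  set F : ℝ → ℝ≥0∞ := fun t ↦ ∫⁻ y in {y : E3 | ‖y‖ ≤ R ∧ ∀ i, 35 * M i ≤ ‖y - p i - t • v i‖},
    ENNReal.ofReal (∑ κ : Fin 4, (fderiv ℝ ψ (E4.ofTimeSpace t y) (E4.basisVector κ)) ^ 2) with hF
  have hn : ∀ n : ℕ, ENNReal.ofReal c₀ * ∫⁻ t in Ioc (0 : ℝ) n, F t ≤ 2 * ENNReal.ofReal (5 + 12 * K + Kζ / R * (1156 * K * ∑ i, M i ^ 2)) * S +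
      ENNReal.ofReal (18 * Kζ + 36 * Kζ * (∑ i, M i ^ 2) + 1) *
        ∑ i, ∫⁻ t in Ioi (0 : ℝ), ∫⁻ y in {y : E3 | (t, y) ∈ Zone i},
          (ENNReal.ofReal (∑ κ : Fin 4, (fderiv ℝ ψ (E4.ofTimeSpace t y) (E4.basisVector κ)) ^ 2) +
            ENNReal.ofReal ((ψ (E4.ofTimeSpace t y) - c) ^ 2 / M i ^ 2)) := fun n ↦
    far_slab_estimate hPH hM hv1 hsep hExtm hext hψ c hnorm hS hStop hζc hζ01 hζ0 hζ1 hζsupp hKζ hJ hBc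
      hB0 hErrc hR hc₀ hBlow hdiv hJb hErrb hZm hshell (Nat.cast_nonneg n)
  have hU : (⋃ n : ℕ, Ioc (0 : ℝ) n) = Ioi 0 := by
    ext t
    simp only [mem_iUnion, mem_Ioc, mem_Ioi]
    exact ⟨fun ⟨_, h0, _⟩ ↦ h0, fun h ↦ ⟨⌈t⌉₊, h, Nat.le_ceil t⟩⟩
  have hmono : Monotone fun n : ℕ ↦ Ioc (0 : ℝ) n := fun m n hmn ↦
    Ioc_subset_Ioc_right (Nat.cast_le.mpr hmn)
  set ν : Measure ℝ := volume.withDensity F with hν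
  have hνeq : ∀ s : Set ℝ, MeasurableSet s → ν s = ∫⁻ t in s, F t := fun s hs ↦ withDensity_apply F hs
  have htend : Tendsto (fun n : ℕ ↦ ν (Ioc 0 n)) atTop (𝓝 (ν (Ioi 0))) := by
    rw [← hU]
    exact tendsto_measure_iUnion_atTop hmono
  have ht2 : Tendsto (fun n : ℕ ↦ ENNReal.ofReal c₀ * ν (Ioc 0 n)) atTop
      (𝓝 (ENNReal.ofReal c₀ * ν (Ioi 0))) :=
    ENNReal.Tendsto.const_mul htend (Or.inr ENNReal.ofReal_ne_top)
  have hlim := le_of_tendsto' ht2 fun n ↦ by rw [hνeq _ measurableSet_Ioc]; exact hn n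
  rwa [hνeq _ measurableSet_Ioi] at hlim

end Summit.FinalStateConjecture.FinalStateConjecture.Cruxes.AdiabaticMultiKerrILED.Sketch

end
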